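import Literature.Probability.Percolation.TriAnnulusCrossingProofs
import Literature.Probability.Percolation.SiteBK
import Literature.Probability.Percolation.DisjointOccurrencePow
import HarnessLib

/-!
# Confined monochromatic arms of site percolation on `δ𝕋` in an annulus, and their iterated BK bound

Topic: Probability / Percolation. The percolation-side input of the multiple-crossing estimate
for the site-percolation exploration path (Aizenman–Burchard, Duke Math. J. 99 (1999), App. A:
"The `k = 1` case … is a particular implication of the Russo–Seymour–Welsh theory. The
statement that `λ(k) → ∞` follows by the van den Berg–Kesten inequality"), in the form consumed
by `TriInterfaceTraversalBound.lean`: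

* `triArm δ x r R` — the event that a chain of open sites of `δ𝕋` (consecutive sites equal or
  adjacent) runs from the disc `B̄(x, r)` to outside `B(x, R)` while staying in `B̄(x, R + 2δ)`
  (a *confined* open arm; confinement makes the event local);
* it is increasing and determined by the finitely many sites of `B̄(x, R + 2δ)`
  (`determinedBy_triArm`), contained in the annulus-crossing event of `TriAnnulusCrossing.lean`
  (`triArm_subset_triAnnulusCrossing`, chains give walks), hence of probability
  `≤ ((r + δ)/(R - δ))^α` at `p = 1/2` by Bollobás–Riordan's annulus lemma
  `tri_annulusCrossing_bound_holds` (`real_triArm_le`);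
* the iterated van den Berg–Kesten inequality for increasing local site events
  (`real_disjointOccurrencePow_le_pow`, from `sitePercolation_bk`), disjoint chains witness
  iterated disjoint occurrence (`mem_disjointOccurrencePow_triArm_of_chains`); closed chains are
  handled downstream by the complementation symmetry of `P_{1/2}`
  (`triSitePercolation_half_real_preimage_compl`, `BrickHex.lean`).

## References

* M. Aizenman, A. Burchard, Duke Math. J. 99 (1999), Appendix A.
* B. Bollobás, O. Riordan, *Percolation* (2006), Ch. 7 Lemma 4; Ch. 5 Lemma 7 (colour flip).
* J. van den Berg, H. Kesten, J. Appl. Probab. 22 (1985) (BK inequality).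
-/

noncomputable section

open Set Metric MeasureTheory

namespace Literature.Probability.Percolation

open LatticeModels

/-! ### Confined open arms -/

/-- **A confined open arm of `δ𝕋` across the annulus `A(x; r, R)`**: a chain of open sites
`f 0, …, f n`, consecutive ones equal or adjacent in `𝕋`, with `δ f 0 ∈ B̄(x, r)`,
`δ f n ∉ B(x, R)`, all within `B̄(x, R + 2δ)`. (AB99 App. A: monochromatic crossings of a shell;
the confinement makes the event local.) [cite: AizenmanBurchardDuke1999, Appendix A] -/
def triArm (δ : ℝ) (x : ℂ) (r R : ℝ) : Set (SiteConfig (Site 2)) :=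
  {ω | ∃ (n : ℕ) (f : ℕ → Site 2), dist (triMeshPoint δ (f 0)) x ≤ r ∧ R ≤ dist (triMeshPoint δ (f n)) x ∧
    (∀ i < n, f i = f (i + 1) ∨ triGraph.Adj (f i) (f (i + 1))) ∧
    ∀ i ≤ n, dist (triMeshPoint δ (f i)) x ≤ R + 2 * δ ∧ f i ∈ ω}

/-- The arm event is increasing. [folklore] -/
theorem isUpperSet_triArm (δ : ℝ) (x : ℂ) (r R : ℝ) : IsUpperSet (triArm δ x r R) := by
  rintro ω ω' hle ⟨n, f, h0, hn, hstep, hconf⟩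
  exact ⟨n, f, h0, hn, hstep, fun i hi ↦ ⟨(hconf i hi).1, hle (hconf i hi).2⟩⟩

/-- The sites of `δ𝕋` in a closed disc (for `δ > 0`) form a finite set. [folklore] -/
theorem finite_setOf_dist_triMeshPoint_le {δ : ℝ} (hδ : 0 < δ) (x : ℂ) (ρ : ℝ) :
    {v : Site 2 | dist (triMeshPoint δ v) x ≤ ρ}.Finite := by
  have h := triMeshVertices_finite_holds (Ω := closedBall x ρ) isBounded_closedBall hδ
  refine h.subset fun v hv ↦ ?_
  exact mem_closedBall.2 hv

/-- **The arm event is determined by the sites of the disc `B̄(x, R + 2δ)`.** [folklore] -/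
theorem determinedBy_triArm (δ : ℝ) (x : ℂ) (r R : ℝ) :
    DeterminedBy (triArm δ x r R) {v : Site 2 | dist (triMeshPoint δ v) x ≤ R + 2 * δ} := by
  rw [determinedBy_iff]
  have key : ∀ ω ω' : SiteConfig (Site 2), ω ∩ {v : Site 2 | dist (triMeshPoint δ v) x ≤ R + 2 * δ} =
      ω' ∩ {v | dist (triMeshPoint δ v) x ≤ R + 2 * δ} → ω ∈ triArm δ x r R → ω' ∈ triArm δ x r R := by
    rintro ω ω' heq ⟨n, f, h0, hn, hstep, hconf⟩
    refine ⟨n, f, h0, hn, hstep, fun i hi ↦ ⟨(hconf i hi).1, ?_⟩⟩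
    have : f i ∈ ω ∩ {v | dist (triMeshPoint δ v) x ≤ R + 2 * δ} := ⟨(hconf i hi).2, (hconf i hi).1⟩
    rw [heq] at this
    exact this.1
  exact fun ω ω' heq ↦ ⟨key ω ω' heq, key ω' ω heq.symm⟩

/-- The arm event is local (for `δ > 0`). [folklore] -/
theorem exists_finset_determinedBy_triArm {δ : ℝ} (hδ : 0 < δ) (x : ℂ) (r R : ℝ) :
    ∃ F : Finset (Site 2), DeterminedBy (triArm δ x r R) ↑F := by
  refine ⟨(finite_setOf_dist_triMeshPoint_le hδ x (R + 2 * δ)).toFinset, ?_⟩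
  rw [Set.Finite.coe_toFinset]
  exact determinedBy_triArm δ x r R

/-- **A chain gives a walk**: if consecutive sites of `f 0, …, f n` are equal or adjacent, there
is a walk of `𝕋` from `f 0` to `f n` supported on these sites. [folklore] -/
theorem exists_triWalk_of_chain (f : ℕ → Site 2) :
    ∀ n : ℕ, (∀ i < n, f i = f (i + 1) ∨ triGraph.Adj (f i) (f (i + 1))) →
      ∃ w : triGraph.Walk (f 0) (f n), ∀ v ∈ w.support, ∃ i ≤ n, v = f i
  | 0 => fun _ ↦ ⟨SimpleGraph.Walk.nil, fun v hv ↦ ⟨0, le_rfl, by simpa using hv⟩⟩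
  | n + 1 => fun h ↦ by
    obtain ⟨w, hw⟩ := exists_triWalk_of_chain f n fun i hi ↦ h i (by omega)
    rcases h n (by omega) with he | hadj
    · refine ⟨w.copy rfl he, fun v hv ↦ ?_⟩
      rw [SimpleGraph.Walk.support_copy] at hv
      obtain ⟨i, hi, rfl⟩ := hw v hv
      exact ⟨i, by omega, rfl⟩
    · refine ⟨w.concat hadj, fun v hv ↦ ?_⟩
      rw [SimpleGraph.Walk.support_concat, List.mem_append, List.mem_singleton] at hv
      rcases hv with hv | rfl
      · obtain ⟨i, hi, rfl⟩ := hw v hv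
        exact ⟨i, by omega, rfl⟩
      · exact ⟨n + 1, le_rfl, rfl⟩

/-- **Confined arms are annulus crossings** in the sense of `TriAnnulusCrossing.lean` (strict
inequalities there, hence the margins `r < r₁`, `r₂ < R`). [folklore] -/
theorem triArm_subset_triAnnulusCrossing {δ : ℝ} {x : ℂ} {r R r₁ r₂ : ℝ} (hr : r < r₁) (hR : r₂ < R) :
    triArm δ x r R ⊆ triAnnulusCrossing true δ x r₁ r₂ := by
  rintro ω ⟨n, f, h0, hn, hstep, hconf⟩
  obtain ⟨w, hw⟩ := exists_triWalk_of_chain f n hstep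
  refine ⟨f 0, f n, w, ?_, ?_, fun v hv ↦ ?_⟩
  · rw [← dist_eq_norm]; exact h0.trans_lt hr
  · rw [← dist_eq_norm]; exact hR.trans_le hn
  · obtain ⟨i, hi, rfl⟩ := hw v hv
    simpa using (hconf i hi).2

/-- **RSW bound for a confined arm at `p = 1/2`**: with the exponent `α` of
`tri_annulusCrossing_bound`, `P_{1/2}(triArm δ x r R) ≤ ((r + δ)/(R - δ))^α` whenever
`1000 δ ≤ r + δ` and `2 (r + δ) ≤ R - δ`. (Bollobás–Riordan 2006, Ch. 7 Lemma 4.)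
[cite: BollobasRiordan2006, Ch. 7 Lemma 4 (p. 166)] -/
theorem real_triArm_le {α : ℝ}
    (hb : ∀ (c : Bool) (δ : ℝ) (z : ℂ) (r₁ r₂ : ℝ), 0 < δ → 1000 * δ ≤ r₁ → 2 * r₁ ≤ r₂ →
      (triSitePercolation half).real (triAnnulusCrossing c δ z r₁ r₂) ≤ (r₁ / r₂) ^ α)
    {δ : ℝ} (hδ : 0 < δ) (x : ℂ) {r R : ℝ} (h1 : 1000 * δ ≤ r + δ) (h2 : 2 * (r + δ) ≤ R - δ) :
    (triSitePercolation half).real (triArm δ x r R) ≤ ((r + δ) / (R - δ)) ^ α :=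
  (measureReal_mono (triArm_subset_triAnnulusCrossing (by linarith) (by linarith))).trans
    (hb true δ x (r + δ) (R - δ) hδ h1 h2)

/-! ### Iterated BK for increasing local site events -/

/-- **Iterated van den Berg–Kesten inequality for site percolation**: for an increasing event
`A` determined by finitely many sites, `P_p(A □^n) ≤ P_p(A)^n`. (van den Berg–Kesten 1985;
Grimmett 1999, Thm 2.12 and (2.14).) [cite: vandenBergKestenJAP1985, Theorem (BK inequality)] -/
theorem real_disjointOccurrencePow_le_pow {V : Type*} (p : unitInterval) {A : Set (SiteConfig V)} {F : Finset V}
    (hAF : DeterminedBy A ↑F) (hA : IsUpperSet A) :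
    ∀ n : ℕ, (sitePercolation V p).real (disjointOccurrencePow A n) ≤ ((sitePercolation V p).real A) ^ n
  | 0 => by simp
  | n + 1 => by
    rw [disjointOccurrencePow_succ, pow_succ']
    calc (sitePercolation V p).real (A □ disjointOccurrencePow A n)
        ≤ (sitePercolation V p).real A * (sitePercolation V p).real (disjointOccurrencePow A n) :=
          sitePercolation_bk p hAF (hAF.disjointOccurrencePow n) hA (hA.disjointOccurrencePow n)
      _ ≤ (sitePercolation V p).real A * ((sitePercolation V p).real A) ^ n :=
          mul_le_mul_of_nonneg_left (real_disjointOccurrencePow_le_pow p hAF hA n) measureReal_nonneg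

/-! ### Disjoint chains witness iterated disjoint occurrence -/

/-- **A chain of sites in either orientation is a confined arm of its own site set.** [folklore] -/
theorem mem_triArm_of_chain {δ : ℝ} {x : ℂ} {r R : ℝ} (N : ℕ) (f : ℕ → Site 2)
    (hstep : ∀ i < N, f i = f (i + 1) ∨ triGraph.Adj (f i) (f (i + 1)))
    (hconf : ∀ i ≤ N, dist (triMeshPoint δ (f i)) x ≤ R + 2 * δ)
    (hends : (dist (triMeshPoint δ (f 0)) x ≤ r ∧ R ≤ dist (triMeshPoint δ (f N)) x) ∨
      (R ≤ dist (triMeshPoint δ (f 0)) x ∧ dist (triMeshPoint δ (f N)) x ≤ r)) :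
    {v | ∃ i ≤ N, v = f i} ∈ triArm δ x r R := by
  rcases hends with ⟨h0, hN⟩ | ⟨h0, hN⟩
  · exact ⟨N, f, h0, hN, hstep, fun i hi ↦ ⟨hconf i hi, i, hi, rfl⟩⟩
  · -- reverse the chain
    refine ⟨N, fun i ↦ f (N - i), by simpa using hN, by simpa using h0, fun i hi ↦ ?_, fun i hi ↦ ⟨hconf _ (by omega), N - i, by omega, rfl⟩⟩
    have h := hstep (N - (i + 1)) (by omega)
    rw [show N - (i + 1) + 1 = N - i by omega] at h
    rcases h with h | h
    · exact Or.inl h.symm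
    · exact Or.inr h.symm

/-- **Pairwise disjoint open chains give iterated disjoint occurrence of the arm event.**
[cite: AizenmanBurchardDuke1999, Appendix A] -/
theorem mem_disjointOccurrencePow_triArm_of_chains {δ : ℝ} {x : ℂ} {r R : ℝ} {ω : SiteConfig (Site 2)} {j : ℕ}
    (N : Fin j → ℕ) (f : Fin j → ℕ → Site 2)
    (hstep : ∀ i, ∀ p < N i, f i p = f i (p + 1) ∨ triGraph.Adj (f i p) (f i (p + 1)))
    (hconf : ∀ i, ∀ p ≤ N i, dist (triMeshPoint δ (f i p)) x ≤ R + 2 * δ)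
    (hopen : ∀ i, ∀ p ≤ N i, f i p ∈ ω)
    (hends : ∀ i, (dist (triMeshPoint δ (f i 0)) x ≤ r ∧ R ≤ dist (triMeshPoint δ (f i (N i))) x) ∨
      (R ≤ dist (triMeshPoint δ (f i 0)) x ∧ dist (triMeshPoint δ (f i (N i))) x ≤ r))
    (hdisj : ∀ i i', i ≠ i' → ∀ p p', p ≤ N i → p' ≤ N i' → f i p ≠ f i' p') :
    ω ∈ disjointOccurrencePow (triArm δ x r R) j := by
  refine mem_disjointOccurrencePow_of_pairwise_disjoint (isUpperSet_triArm δ x r R)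
    (fun i ↦ {v | ∃ p ≤ N i, v = f i p}) (fun i ↦ ?_) (fun i ↦ mem_triArm_of_chain (N i) (f i) (hstep i) (hconf i) (hends i))
    (fun i i' hii ↦ Set.disjoint_left.2 ?_)
  · rintro v ⟨p, hp, rfl⟩; exact hopen i p hp
  · rintro v ⟨p, hp, rfl⟩ ⟨p', hp', h⟩
    exact hdisj i i' hii p p' hp hp' h

end Literature.Probability.Percolation
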